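import Summits.CriticalPhenomena.SAWScalingLimit.Theorems.SAWDefectDecoherenceBoundaryClosureRInnerZigzagAssembly
import Summits.CriticalPhenomena.SAWScalingLimit.Theorems.SAWDefectDecoherenceBoundaryClosureRInnerZigzagInside
import HarnessLib

/-!
# Crux `BoundaryClosureR` (stmt-CriticalPhenomena-14004), line `polygon-parity-squeeze`,
# stub `stub_innerZigzagPolygon` (7a): the inside of the boundary cycle lies in `Ω`, contains the
# two pinned half-balls, the anchor face and every deep connected set through the pins

Landing target:
`Summits/CriticalPhenomena/SAWScalingLimit/Theorems/SAWDefectDecoherenceBoundaryClosureRInnerZigzagCarrier.lean`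
(`--supports stmt-CriticalPhenomena-14004`; building block C3 of the registered stub
`stub_innerZigzagPolygon`, the continuum half of the inner-polygon construction (IP)).

Normalised coordinates; `K = tileFaces S ∪ R₁ ∪ R₀` as in `…InnerZigzagAssembly.lean`, boundary walk
from the anchor dart `(0, 0)`, `P` the polygonal domain of its cycle, `V` the outside, and `X₁` the
normalised complement of `Ω` minus the two open windows under the pins (connected and unbounded —
supplied by the caller from `isConnected_compl_carrier_diff_two_windows`).  Then:

* `windowsComplement_subset_outside` — `X₁` misses the cycle (cells of `K` are in `Ω` or on the two
  bases, inside the windows), so `X₁ ⊆ V`;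
* `carrier_subset_domain` — **`P ⊆ Ω`** (a point of `P` off `Ω` is in a window, on or below its pin
  line; straight below it, off the cycle, sits a point of `X₁ ⊆ V`: `vertical_escape`);
* `upper_one_subset_carrier`, `anchor_inside` — the open upper half-ball of radius `(7/8)ρ/h` at the
  gate pin is inside (it misses the cycle by `mem_K_of_upper_one`, is convex, and inside points
  accumulate at the pin `0 ∈ Γ`, above the gate since `P ⊆ Ω`); hence the open left cell of the
  anchor dart is inside — the base case of `leftFace_inside`;
* `deep_connected_subset_carrier` — a connected set of `9h`-deep points through `iρ/(2h)` and
  `p0n + i r₁/(2h)` is inside, and so is the upper half-ball of radius `(7/8)r₁/h` at the root pin.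

Sources: folklore; J. McCleary, *A First Course in Topology* (2006), Ch. 9 (Jordan curve theorem,
through the tree).  No definition and no named fact is introduced.
-/

noncomputable section

open scoped ComplexConjugate
open Set Metric
open Literature.Probability.LatticeModels
open Literature.Probability.Percolation (triX triY triCell triCellStrict triX_triEmbed triY_triEmbed triDir
  exists_mem_triCell)
open Literature.Probability.RandomPlanarGeometry
open Summit.CriticalPhenomena.SAWScalingLimit.Theorems.PolygonParitySqueeze.BoundaryWalk

namespace Summit.CriticalPhenomena.SAWScalingLimit.Theorems.PolygonParitySqueeze.InnerZigzag

section Carrier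

variable {Ω : Set ℂ} {o p0n : ℂ} {h ρ r₁ : ℝ} {N X₀ a a₀ : ℤ} {S : Finset (Site 2)} {R₁ R₀ : Finset HexVertex}
  (hh : 0 < h) (hρ : 4000 * h ≤ ρ) (hr₁ : 4000 * h ≤ r₁)
  (hflat1 : ∀ w : ℂ, ‖w‖ < ρ / h → (o + h * w ∈ Ω ↔ 0 < w.im))
  (hflat0 : ∀ w : ℂ, ‖w - p0n‖ < r₁ / h → (o + h * w ∈ Ω ↔ p0n.im < w.im))
  (hp0n : triY p0n = N ∧ |triX p0n - X₀| ≤ 1 / 2)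
  (hdist : ρ / h + r₁ / h ≤ ‖p0n‖)
  (ha : (a : ℝ) ≤ 9 / 10 * (ρ / h) ∧ 9 / 10 * (ρ / h) - 1 < a)
  (ha₀ : (a₀ : ℝ) ≤ 9 / 10 * (r₁ / h) ∧ 9 / 10 * (r₁ / h) - 1 < a₀)
  (hS : ∀ c : Site 2, c ∈ S ↔ (c 0 - c 1) % 3 = 0 ∧ 5 * h ≤ infDist (o + h * triEmbed c) Ωᶜ)
  (hR₁ : ∀ F : HexVertex, F ∈ R₁ ↔
    ∀ v ∈ hexFaceVertices F, 0 ≤ v 1 ∧ v 1 ≤ 0 + 20 ∧ 0 - a ≤ v 0 ∧ (v 0 - 0) + (v 1 - 0) ≤ a)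
  (hR₀ : ∀ F : HexVertex, F ∈ R₀ ↔
    ∀ v ∈ hexFaceVertices F, N ≤ v 1 ∧ v 1 ≤ N + 20 ∧ X₀ - a₀ ≤ v 0 ∧ (v 0 - X₀) + (v 1 - N) ≤ a₀)
  (hdepth1 : ∀ w : ℂ, ‖w‖ < ρ / h → min (h * w.im) (ρ - h * ‖w‖) ≤ infDist (o + h * w) Ωᶜ)
  (hdepth0 : ∀ w : ℂ, ‖w - p0n‖ < r₁ / h → min (h * (w - p0n).im) (r₁ - h * ‖w - p0n‖) ≤ infDist (o + h * w) Ωᶜ)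
  {X₁ : Set ℂ} (hX₁ : IsConnected X₁ ∧ ¬ Bornology.IsBounded X₁ ∧ ∀ w : ℂ, w ∈ X₁ ↔
    (o + h * w ∉ Ω ∧ ¬ (|w.re| < a + 25 ∧ |w.im| < 1) ∧ ¬ (|(w - p0n).re| < a₀ + 25 ∧ |(w - p0n).im| < 1)))
  {Per : ℕ} (hs : IsSimpleClosedPolygon (bverts (tileFaces S ∪ R₁ ∪ R₀) 0 1 ((0 : Site 2), (0 : Fin 6)) Per))
  (hPd : bwalk (tileFaces S ∪ R₁ ∪ R₀) ((0 : Site 2), (0 : Fin 6)) Per = ((0 : Site 2), (0 : Fin 6)))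
  {V : Set ℂ} (hV : IsOpen V ∧
    Disjoint (polygonDomain (bverts (tileFaces S ∪ R₁ ∪ R₀) 0 1 ((0 : Site 2), (0 : Fin 6)) Per) hs).carrier V ∧
    (polygonDomain (bverts (tileFaces S ∪ R₁ ∪ R₀) 0 1 ((0 : Site 2), (0 : Fin 6)) Per) hs).carrier ∪ V =
      (frontier (polygonDomain (bverts (tileFaces S ∪ R₁ ∪ R₀) 0 1 ((0 : Site 2), (0 : Fin 6)) Per) hs).carrier)ᶜ ∧
    frontier V = frontier (polygonDomain (bverts (tileFaces S ∪ R₁ ∪ R₀) 0 1 ((0 : Site 2), (0 : Fin 6)) Per) hs).carrier)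

/-! ### 1. The normalised window complement is outside -/

include hh hρ hr₁ hflat1 hflat0 hp0n hdist ha ha₀ hS hR₁ hR₀ hX₁ hPd hV in
/-- **Every point of the cycle is in `Ω`, or in the gate window on the gate line, or in the root
window on the root line; in particular the window complement `X₁` misses the cycle and lies in the
outside.** [folklore] -/
theorem windowsComplement_subset_outside : X₁ ⊆ V := by
  set P := (polygonDomain (bverts (tileFaces S ∪ R₁ ∪ R₀) 0 1 ((0 : Site 2), (0 : Fin 6)) Per) hs).carrier with hP
  have h₀ := d0_mem_bdDarts hh hρ hr₁ hflat1 hp0n hdist ha ha₀ hS hR₁ hR₀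
  have hdisj : Disjoint X₁ (frontier P) := by
    rw [Set.disjoint_left]
    intro w hwX hwΓ
    obtain ⟨t, -, hzL, -, hL, -⟩ := exists_cells_of_mem_frontier hs h₀ hPd hwΓ
    obtain ⟨hXΩ, hW1, hW0⟩ := (hX₁.2.2 w).1 hwX
    rcases K_cell_cases hh hρ hr₁ hflat1 hflat0 hp0n ha ha₀ hS hR₁ hR₀ hL hzL with hin | ⟨him, hn⟩ | ⟨him, hn⟩
    · exact hXΩ hin
    · refine hW1 ⟨?_, by rw [him, abs_zero]; norm_num⟩
      exact lt_of_le_of_lt ((Complex.abs_re_le_norm w).trans hn) (by linarith)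
    · refine hW0 ⟨?_, by rw [Complex.sub_im, him, sub_self, abs_zero]; norm_num⟩
      exact lt_of_le_of_lt ((Complex.abs_re_le_norm (w - p0n)).trans hn) (by linarith)
  rcases subset_carrier_or_outside hs hV hX₁.1.isPreconnected hdisj with h1 | h1
  · exact absurd ((polygonDomain _ hs).isBounded.subset h1) hX₁.2.1
  · exact h1

/-! ### 2. The inside lies in `Ω` -/

include hh hρ hr₁ hflat1 hflat0 hp0n hdist ha ha₀ hS hR₁ hR₀ hX₁ hPd hV in
/-- **The inside of the cycle lies in `Ω`.**  A point `w ∈ P` off `Ω` is not in `X₁ ⊆ V`, hence in a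
window, on or below its pin line; the vertical segment down to the bottom of the window misses the
cycle (its points below the line are off `Ω`, off both bases) and ends in `X₁ ⊆ V` — impossible by
`vertical_escape`. [folklore] -/
theorem carrier_subset_domain :
    (polygonDomain (bverts (tileFaces S ∪ R₁ ∪ R₀) 0 1 ((0 : Site 2), (0 : Fin 6)) Per) hs).carrier ⊆
      {w : ℂ | o + h * w ∈ Ω} := by
  set P := (polygonDomain (bverts (tileFaces S ∪ R₁ ∪ R₀) 0 1 ((0 : Site 2), (0 : Fin 6)) Per) hs).carrier with hP
  have hPo : IsOpen P := (polygonDomain _ hs).isOpen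
  have h₀ := d0_mem_bdDarts hh hρ hr₁ hflat1 hp0n hdist ha ha₀ hS hR₁ hR₀
  have hXV := windowsComplement_subset_outside hh hρ hr₁ hflat1 hflat0 hp0n hdist ha ha₀ hS hR₁ hR₀ hX₁ hs hPd hV
  have hρh : 4000 ≤ ρ / h := by rw [le_div_iff₀ hh]; linarith
  have hrh : 4000 ≤ r₁ / h := by rw [le_div_iff₀ hh]; linarith
  -- points of the cycle: in `Ω`, or on the two bases
  have hcyc : ∀ u ∈ frontier P, o + h * u ∈ Ω ∨ (u.im = 0 ∧ ‖u‖ ≤ a + 24) ∨ (u.im = p0n.im ∧ ‖u - p0n‖ ≤ a₀ + 49 / 2) := by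
    intro u hu
    obtain ⟨t, -, hzL, -, hL, -⟩ := exists_cells_of_mem_frontier hs h₀ hPd hu
    exact K_cell_cases hh hρ hr₁ hflat1 hflat0 hp0n ha ha₀ hS hR₁ hR₀ hL hzL
  intro w hwP
  by_contra hwΩ
  simp only [mem_setOf_eq] at hwΩ
  have hwX : w ∉ X₁ := fun hx => Set.disjoint_left.1 hV.2.1 hwP (hXV hx)
  have tri : ∀ u : ℂ, ‖p0n‖ ≤ ‖u‖ + ‖u - p0n‖ := fun u => by
    have := norm_sub_le u (u - p0n); rwa [sub_sub_cancel] at this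
  have nle : ∀ u : ℂ, ‖u‖ ≤ |u.re| + |u.im| := fun u => Complex.norm_le_abs_re_add_abs_im u
  by_cases hW1 : |w.re| < a + 25 ∧ |w.im| < 1
  · -- the gate window: `im w ≤ 0`
    have hre := abs_lt.1 hW1.1
    have hwn : ‖w‖ < ρ / h := by linarith [nle w, hW1.1, hW1.2, ha.1]
    have him : w.im ≤ 0 := not_lt.1 fun hpos => hwΩ ((hflat1 w hwn).2 hpos)
    refine vertical_escape hPo hV.1 hV.2.1 hV.2.2.1 hwP (σ := -1) (by linarith [(abs_lt.1 hW1.2).1]) ?_ ?_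
    · intro s hs1 hs2 hsΓ
      have hs0 : s < 0 := lt_of_lt_of_le hs2 him
      have habs : |s| ≤ 1 := abs_le.2 ⟨by linarith, by linarith⟩
      have hun : ‖(⟨w.re, s⟩ : ℂ)‖ < a + 26 := by linarith [nle ⟨w.re, s⟩, hW1.1]
      rcases hcyc _ hsΓ with hin | ⟨him0, -⟩ | ⟨him0, hn⟩
      · have := (hflat1 _ (by linarith [ha.1])).1 hin
        simp only at this; linarith
      · simp only at him0; linarith
      · linarith [tri ⟨w.re, s⟩, ha.1, ha₀.1]
    · apply hXV
      rw [hX₁.2.2]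
      have hun : ‖(⟨w.re, -1⟩ : ℂ)‖ < a + 26 := by
        have := nle ⟨w.re, -1⟩
        have e : |(-1 : ℝ)| = 1 := by norm_num
        simp only [e] at this
        linarith [hW1.1]
      refine ⟨fun hin => ?_, fun hw1 => ?_, fun hw0 => ?_⟩
      · have := (hflat1 _ (by linarith [ha.1])).1 hin
        simp only at this; linarith
      · have h1 := (abs_lt.1 hw1.2).1
        simp only at h1
        norm_num at h1
      · -- the root window is far
        have h1 := abs_lt.1 hw0.1
        have h2 := abs_lt.1 hw0.2
        simp only [Complex.sub_re, Complex.sub_im] at h1 h2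
        have e1 : |p0n.re| ≤ |w.re| + (a₀ + 25) := by
          rw [abs_le]; constructor <;> cases abs_cases w.re <;> linarith
        have e2 : |p0n.im| ≤ 2 := by rw [abs_le]; constructor <;> linarith
        linarith [nle p0n, hW1.1, ha.1, ha₀.1]
  · by_cases hW0 : |(w - p0n).re| < a₀ + 25 ∧ |(w - p0n).im| < 1
    · -- the root window: `im w ≤ im p0n`
      have h1 := abs_lt.1 hW0.1
      have hb := abs_lt.1 hW0.2
      rw [Complex.sub_re] at h1
      rw [Complex.sub_im] at hb
      have hwn : ‖w - p0n‖ < r₁ / h := by linarith [nle (w - p0n), hW0.1, hW0.2, ha₀.1]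
      have him : w.im ≤ p0n.im := not_lt.1 fun hpos => hwΩ ((hflat0 w hwn).2 hpos)
      refine vertical_escape hPo hV.1 hV.2.1 hV.2.2.1 hwP (σ := p0n.im - 1) (by linarith) ?_ ?_
      · intro s hs1 hs2 hsΓ
        have hs0 : s < p0n.im := lt_of_lt_of_le hs2 him
        have hun : ‖(⟨w.re, s⟩ : ℂ) - p0n‖ < a₀ + 26 := by
          have := nle ((⟨w.re, s⟩ : ℂ) - p0n)
          simp only [Complex.sub_re, Complex.sub_im] at this
          have e1 : |w.re - p0n.re| < a₀ + 25 := abs_lt.2 ⟨by linarith, by linarith⟩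
          have e2 : |s - p0n.im| ≤ 1 := abs_le.2 ⟨by linarith, by linarith⟩
          linarith
        rcases hcyc _ hsΓ with hin | ⟨him0, hn⟩ | ⟨him0, -⟩
        · have := (hflat0 _ (by linarith [ha₀.1])).1 hin
          simp only at this; linarith
        · linarith [tri ⟨w.re, s⟩, ha.1, ha₀.1]
        · simp only at him0; linarith
      · apply hXV
        rw [hX₁.2.2]
        have hun : ‖(⟨w.re, p0n.im - 1⟩ : ℂ) - p0n‖ < a₀ + 26 := by
          have := nle ((⟨w.re, p0n.im - 1⟩ : ℂ) - p0n)
          simp only [Complex.sub_re, Complex.sub_im] at this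
          have e1 : |w.re - p0n.re| < a₀ + 25 := abs_lt.2 ⟨by linarith, by linarith⟩
          have e2 : |p0n.im - 1 - p0n.im| = 1 := by rw [show p0n.im - 1 - p0n.im = -1 by ring]; norm_num
          linarith
        refine ⟨fun hin => ?_, fun hw1 => ?_, fun hw0 => ?_⟩
        · have := (hflat0 _ (by linarith [ha₀.1])).1 hin
          simp only at this; linarith
        · -- the gate window is far
          have g1 := abs_lt.1 hw1.1
          have g2 := abs_lt.1 hw1.2
          simp only at g1 g2
          have e1 : |p0n.re| ≤ (a + 25) + (a₀ + 25) := by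
            rw [abs_le]; constructor <;> linarith
          have e2 : |p0n.im| ≤ 2 := by rw [abs_le]; constructor <;> linarith
          linarith [nle p0n, ha.1, ha₀.1]
        · have := (abs_lt.1 hw0.2).1
          simp only [Complex.sub_im] at this
          linarith
    · exact hwX ((hX₁.2.2 w).2 ⟨hwΩ, hW1, hW0⟩)

/-! ### 3. The gate half-ball and the anchor face are inside -/

include hh hρ hr₁ hflat1 hflat0 hp0n hdist ha ha₀ hS hR₁ hR₀ hdepth1 hX₁ hPd hV in
/-- **The open upper half-ball of radius `(7/8)ρ/h` at the gate pin is inside.** It misses the cycle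
(every cell meeting it is in `K`, `mem_K_of_upper_one`, while cycle points lie in non-`K` cells), is
convex, and meets `P`: the pin `0` is on the cycle, so inside points accumulate at `0`, and they are
above the gate because `P ⊆ Ω`. [folklore] -/
theorem upper_one_subset_carrier :
    {w : ℂ | 0 < w.im} ∩ ball (0 : ℂ) (7 / 8 * (ρ / h)) ⊆
      (polygonDomain (bverts (tileFaces S ∪ R₁ ∪ R₀) 0 1 ((0 : Site 2), (0 : Fin 6)) Per) hs).carrier := by
  set P := (polygonDomain (bverts (tileFaces S ∪ R₁ ∪ R₀) 0 1 ((0 : Site 2), (0 : Fin 6)) Per) hs).carrier with hP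
  have h₀ := d0_mem_bdDarts hh hρ hr₁ hflat1 hp0n hdist ha ha₀ hS hR₁ hR₀
  have hsub := carrier_subset_domain hh hρ hr₁ hflat1 hflat0 hp0n hdist ha ha₀ hS hR₁ hR₀ hX₁ hs hPd hV
  have hρh : 4000 ≤ ρ / h := by rw [le_div_iff₀ hh]; linarith
  -- the half-ball misses the cycle
  have hdisj : Disjoint ({w : ℂ | 0 < w.im} ∩ ball (0 : ℂ) (7 / 8 * (ρ / h))) (frontier P) := by
    rw [Set.disjoint_left]
    rintro w ⟨hwi, hwB⟩ hwΓ
    obtain ⟨t, -, -, hzR, -, hR⟩ := exists_cells_of_mem_frontier hs h₀ hPd hwΓ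
    rw [mem_ball, dist_zero_right] at hwB
    exact hR (mem_K_of_upper_one hh hρ ha hS hR₁ hdepth1 hzR hwB hwi)
  -- convexity
  have hconv : Convex ℝ ({w : ℂ | 0 < w.im} ∩ ball (0 : ℂ) (7 / 8 * (ρ / h))) :=
    (convex_halfSpace_gt Complex.imLm.isLinear 0).inter (convex_ball _ _)
  -- an inside point above the gate
  have h0Γ : (0 : ℂ) ∈ frontier P := by
    refine (mem_frontier_iff hs h₀ hPd).2 ⟨0, ?_, ?_⟩
    · by_contra hP0
      have : Per = 0 := by omega
      subst this
      exact absurd hs.pos (by rw [length_bverts]; omega)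
    · show (0 : ℂ) ∈ segment ℝ (triEmbed (bwalk (tileFaces S ∪ R₁ ∪ R₀) (0, 0) 0).1) _
      have e : (bwalk (tileFaces S ∪ R₁ ∪ R₀) ((0 : Site 2), (0 : Fin 6)) 0).1 = 0 := rfl
      rw [e, triEmbed_zero]
      exact left_mem_segment ℝ _ _
  have h0cl : (0 : ℂ) ∈ closure P := frontier_subset_closure h0Γ
  obtain ⟨p, hpB, hpP⟩ : (ball (0 : ℂ) 1 ∩ P).Nonempty := mem_closure_iff_nhds.1 h0cl _ (ball_mem_nhds _ one_pos)
  have hpΩ := hsub hpP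
  simp only [mem_setOf_eq] at hpΩ
  rw [mem_ball, dist_zero_right] at hpB
  have hpim : 0 < p.im := (hflat1 p (by linarith)).1 hpΩ
  exact subset_carrier_of_convex hs hV hconv hdisj ⟨p, ⟨hpim, by rw [mem_ball, dist_zero_right]; linarith⟩, hpP⟩

include hh hρ hr₁ hflat1 hflat0 hp0n hdist ha ha₀ hS hR₁ hR₀ hdepth1 hX₁ hPd hV in
/-- **The open left cell of the anchor dart is inside** (it lies in the gate half-ball): the base
case of `leftFace_inside`. [folklore] -/
theorem anchor_inside :
    triCellStrict (faceL ((0 : Site 2), (0 : Fin 6)).1 ((0 : Site 2), (0 : Fin 6)).2) ⊆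
      (polygonDomain (bverts (tileFaces S ∪ R₁ ∪ R₀) 0 1 ((0 : Site 2), (0 : Fin 6)) Per) hs).carrier := by
  have hup := upper_one_subset_carrier hh hρ hr₁ hflat1 hflat0 hp0n hdist ha ha₀ hS hR₁ hR₀ hdepth1 hX₁ hs hPd hV
  have hρh : 4000 ≤ ρ / h := by rw [le_div_iff₀ hh]; linarith
  intro w hw
  apply hup
  simp only at hw
  obtain ⟨s0, -⟩ := triCellStrict_faceL_iff 0 w
  obtain ⟨h1, h2, h3⟩ := s0.1 hw
  simp only [Pi.zero_apply, Int.cast_zero, sub_zero] at h1 h2 h3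
  have hn := Literature.Probability.Percolation.norm_sub_triEmbed_le_of_mem_triCell
    (Literature.Probability.Percolation.triCellStrict_subset_triCell _ hw)
  have e : (faceL (0 : Site 2) 0).1 = 0 := rfl
  rw [e, triEmbed_zero, sub_zero] at hn
  refine ⟨(triY_pos_iff w).1 h2, ?_⟩
  rw [mem_ball, dist_zero_right]
  linarith

/-! ### 4. Deep connected sets through the pins, and the root half-ball -/

include hh hρ hr₁ hflat1 hflat0 hp0n hdist ha ha₀ hS hR₁ hR₀ hdepth1 hdepth0 hX₁ hPd hV in
/-- **A connected set of `9h`-deep points through `iρ/(2h)` and `p0n + i r₁/(2h)` is inside, together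
with the open upper half-ball of radius `(7/8)r₁/h` at the root pin.** (The union of the gate
half-ball, the set and the root half-ball is preconnected, misses the cycle — every cell it meets is in
`K` — and meets `P` in the gate half-ball.) [folklore] -/
theorem deep_connected_subset_carrier {C : Set ℂ} (hC : IsConnected C)
    (hCdeep : ∀ w ∈ C, 9 * h ≤ infDist (o + h * w) Ωᶜ) (hC1 : Complex.I * ((ρ / (2 * h) : ℝ) : ℂ) ∈ C)
    (hC0 : p0n + Complex.I * ((r₁ / (2 * h) : ℝ) : ℂ) ∈ C) :
    C ⊆ (polygonDomain (bverts (tileFaces S ∪ R₁ ∪ R₀) 0 1 ((0 : Site 2), (0 : Fin 6)) Per) hs).carrier ∧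
    {w : ℂ | p0n.im < w.im} ∩ ball p0n (7 / 8 * (r₁ / h)) ⊆
      (polygonDomain (bverts (tileFaces S ∪ R₁ ∪ R₀) 0 1 ((0 : Site 2), (0 : Fin 6)) Per) hs).carrier := by
  set P := (polygonDomain (bverts (tileFaces S ∪ R₁ ∪ R₀) 0 1 ((0 : Site 2), (0 : Fin 6)) Per) hs).carrier with hP
  have h₀ := d0_mem_bdDarts hh hρ hr₁ hflat1 hp0n hdist ha ha₀ hS hR₁ hR₀
  have hup := upper_one_subset_carrier hh hρ hr₁ hflat1 hflat0 hp0n hdist ha ha₀ hS hR₁ hR₀ hdepth1 hX₁ hs hPd hV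
  have hρh : 4000 ≤ ρ / h := by rw [le_div_iff₀ hh]; linarith
  have hrh : 4000 ≤ r₁ / h := by rw [le_div_iff₀ hh]; linarith
  set B1 := {w : ℂ | 0 < w.im} ∩ ball (0 : ℂ) (7 / 8 * (ρ / h)) with hB1
  set B0 := {w : ℂ | p0n.im < w.im} ∩ ball p0n (7 / 8 * (r₁ / h)) with hB0
  -- every cell meeting the union is in `K`, so the union misses the cycle
  have hKcell : ∀ w ∈ B1 ∪ C ∪ B0, ∀ F : HexVertex, w ∈ triCell F → F ∈ tileFaces S ∪ R₁ ∪ R₀ := by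
    rintro w ((⟨hwi, hwB⟩ | hwC) | ⟨hwi, hwB⟩) F hwF
    · rw [mem_ball, dist_zero_right] at hwB
      exact mem_K_of_upper_one hh hρ ha hS hR₁ hdepth1 hwF hwB hwi
    · exact mem_K_of_deep hh hS hwF (hCdeep w hwC)
    · rw [mem_ball, dist_eq_norm] at hwB
      exact mem_K_of_upper_zero hh hr₁ hp0n ha₀ hS hR₀ hdepth0 hwF hwB hwi
  have hdisj : Disjoint (B1 ∪ C ∪ B0) (frontier P) := by
    rw [Set.disjoint_left]
    intro w hw hwΓ
    obtain ⟨t, -, -, hzR, -, hR⟩ := exists_cells_of_mem_frontier hs h₀ hPd hwΓ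
    exact hR (hKcell w hw _ hzR)
  -- preconnectedness through the two pin points
  have hmeet1 : Complex.I * ((ρ / (2 * h) : ℝ) : ℂ) ∈ B1 := by
    have hq : ρ / (2 * h) = (ρ / h) / 2 := by rw [div_div, mul_comm]
    refine ⟨?_, ?_⟩
    · simp only [mem_setOf_eq, Complex.mul_im, Complex.I_re, Complex.I_im, Complex.ofReal_re, Complex.ofReal_im,
        zero_mul, one_mul]
      rw [hq]; linarith
    · rw [mem_ball, dist_zero_right, norm_mul, Complex.norm_I, one_mul, Complex.norm_real,
        Real.norm_of_nonneg (by rw [hq]; linarith), hq]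
      linarith
  have hmeet0 : p0n + Complex.I * ((r₁ / (2 * h) : ℝ) : ℂ) ∈ B0 := by
    have hq : r₁ / (2 * h) = (r₁ / h) / 2 := by rw [div_div, mul_comm]
    refine ⟨?_, ?_⟩
    · simp only [mem_setOf_eq, Complex.add_im, Complex.mul_im, Complex.I_re, Complex.I_im, Complex.ofReal_re,
        Complex.ofReal_im, zero_mul, one_mul]
      rw [hq]; linarith
    · rw [mem_ball, dist_eq_norm, add_sub_cancel_left, norm_mul, Complex.norm_I, one_mul, Complex.norm_real,
        Real.norm_of_nonneg (by rw [hq]; linarith), hq]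
      linarith
  have hconv1 : Convex ℝ B1 := (convex_halfSpace_gt Complex.imLm.isLinear 0).inter (convex_ball _ _)
  have hconv0 : Convex ℝ B0 := (convex_halfSpace_gt Complex.imLm.isLinear _).inter (convex_ball _ _)
  have hpre : IsPreconnected (B1 ∪ C ∪ B0) :=
    (hconv1.isPreconnected.union _ hmeet1 hC1 hC.isPreconnected).union _ (Or.inr hC0) hmeet0 hconv0.isPreconnected
  -- the union meets `P` (in the gate half-ball), hence is inside
  have hne : (B1 ∩ P).Nonempty := ⟨_, hmeet1, hup hmeet1⟩
  rcases subset_carrier_or_outside hs hV hpre hdisj with hin | hout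
  · exact ⟨fun w hw => hin (Or.inl (Or.inr hw)), fun w hw => hin (Or.inr hw)⟩
  · obtain ⟨q, hqB, hqP⟩ := hne
    exact absurd (hout (Or.inl (Or.inl hqB))) (Set.disjoint_left.1 hV.2.1 hqP)

end Carrier

/-- **The inside of the boundary cycle lies in `Ω`** (registered form, sub-goal of
`stub_innerZigzagPolygon`). [folklore] -/
theorem inside_subset_domain : ∀ (Ω : Set ℂ) (o p0n : ℂ) (h ρ r₁ : ℝ) (N X₀ a a₀ : ℤ) (S : Finset (Site 2)) (R₁ R₀ : Finset HexVertex) (X₁ : Set ℂ) (Per : ℕ) (hs : IsSimpleClosedPolygon (bverts (tileFaces S ∪ R₁ ∪ R₀) 0 1 ((0 : Site 2), (0 : Fin 6)) Per)) (V : Set ℂ), 0 < h → 4000 * h ≤ ρ → 4000 * h ≤ r₁ → (∀ w : ℂ, ‖w‖ < ρ / h → (o + h * w ∈ Ω ↔ 0 < w.im)) → (∀ w : ℂ, ‖w - p0n‖ < r₁ / h → (o + h * w ∈ Ω ↔ p0n.im < w.im)) → (triY p0n = N ∧ |triX p0n - X₀| ≤ 1 / 2) → ρ / h + r₁ / h ≤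 ‖p0n‖ → ((a : ℝ) ≤ 9 / 10 * (ρ / h) ∧ 9 / 10 * (ρ / h) - 1 < a) → ((a₀ : ℝ) ≤ 9 / 10 * (r₁ / h) ∧ 9 / 10 * (r₁ / h) - 1 < a₀) → (∀ c : Site 2, c ∈ S ↔ (c 0 - c 1) % 3 = 0 ∧ 5 * h ≤ Metric.infDist (o + h * triEmbed c) Ωᶜ) → (∀ F : HexVertex, F ∈ R₁ ↔ ∀ v ∈ hexFaceVertices F, 0 ≤ v 1 ∧ v 1 ≤ 0 + 20 ∧ 0 - a ≤ v 0 ∧ (v 0 - 0) + (v 1 - 0) ≤ a) → (∀ F : HexVertex, F ∈ R₀ ↔ ∀ v ∈ hexFaceVertices F, N ≤ v 1 ∧ v 1 ≤ N + 20 ∧ X₀ - a₀ ≤ v 0 ∧ (v 0 - X₀) + (v 1 - N) ≤ a₀) → (IsConnected X₁ ∧ ¬ Bornology.IsBounded X₁ ∧ ∀ w : ℂ, w ∈ X₁ ↔ (o + h * w ∉ Ω ∧ ¬ (|w.re| < a + 25 ∧ |w.im| < 1) ∧ ¬ (|(w - p0n).re| < a₀ + 25 ∧ |(w - p0n).im|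 < 1))) → bwalk (tileFaces S ∪ R₁ ∪ R₀) ((0 : Site 2), (0 : Fin 6)) Per = ((0 : Site 2), (0 : Fin 6)) → (IsOpen V ∧ Disjoint (polygonDomain (bverts (tileFaces S ∪ R₁ ∪ R₀) 0 1 ((0 : Site 2), (0 : Fin 6)) Per) hs).carrier V ∧ (polygonDomain (bverts (tileFaces S ∪ R₁ ∪ R₀) 0 1 ((0 : Site 2), (0 : Fin 6)) Per) hs).carrier ∪ V = (frontier (polygonDomain (bverts (tileFaces S ∪ R₁ ∪ R₀) 0 1 ((0 : Site 2), (0 : Fin 6)) Per) hs).carrier)ᶜ ∧ frontier V = frontier (polygonDomain (bverts (tileFaces S ∪ R₁ ∪ R₀) 0 1 ((0 : Site 2), (0 : Fin 6)) Per) hs).carrier) → (polygonDomain (bverts (tileFaces S ∪ R₁ ∪ R₀) 0 1 ((0 : Site 2), (0 : Fin 6)) Per) hs).carrier ⊆ {w : ℂ | o + h * w ∈ Ω} :=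
  fun _ _ _ _ _ _ _ _ _ _ _ _ _ _ _ hs _ hh hρ hr₁ hflat1 hflat0 hp0n hdist ha ha₀ hS hR₁ hR₀ hX₁ hPd hV =>
    carrier_subset_domain hh hρ hr₁ hflat1 hflat0 hp0n hdist ha ha₀ hS hR₁ hR₀ hX₁ hs hPd hV

end Summit.CriticalPhenomena.SAWScalingLimit.Theorems.PolygonParitySqueeze.InnerZigzag

end
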